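import Summits.HodgeConjecture.CorCM.Census.TypeStabiliserSubgroup

/-!
# `G/𝒦` has `2`-rank at most two when `𝒦(G,c)` has exponent two

COR-CM (cell `pub-hodgecm2`), count-neutral kernel combinatorics by the census seat lit-andre-3 (gen 21; lane
TYPE-STABILISER-RANKTWO), sequel of `Census/TypeStabiliserSubgroup.lean` (`stabGen c = 𝒦(G,c) = ⟨c, {g | c ∉ ⟨g⟩}⟩`, the subgroup
generated by the type stabilisers).  Pure group theory; theorems only (no definition, no `decide`, no certificate, no named fact,
no `sorry`).  HONEST FRAMING: `HC_CM` is NOT proved, here or anywhere in the tree; nothing here is a period or a headline.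

THE QUESTION (lane memo `HOME/pub-hodgecm2-lit-andre-3/PORTFOLIO-lit-andre-3-g20.md`, Q1–Q3).  In the closed form of the
coinvariant fibre `φ₂ + 1 + [n even] = β + d₂(G/𝒦)` (`Census/TypeStabiliserCharK.lean`) the excess term is the `2`-rank
`d₂ = d(G/𝒦)`.  The gen-20 atlas (all pairs `(G,c)`, `G` a `2`-group of order `≤ 128`) found `d₂ ≤ 3`, the value `3` first at
order `128`, and in the pairs found there with `G/𝒦` not cyclic or dihedral the subgroup `𝒦` is the elementary abelian group
`Ω₁(G)` of all involutions.  This file treats exactly that family: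

  **(K2)  every element of `𝒦 = stabGen c` squares to `1`**  (`hK : ∀ g ∈ stabGen c, g * g = 1`),

equivalently `𝒦` is an elementary abelian `2`-group, equivalently (`c ≠ 1`) `𝒦 = {g | g² = 1}` (`mem_stabGen_iff_mul_self_eq_one`):
the involutions of `G` commute pairwise and `c` is the only involution that is a square.  (Since `𝒦` contains every element of odd
order, (K2) forces a finite `G` to be a `2`-group.)

CONTENT (all under (K2), `c ≠ 1` central).
* §1 `mul_self_eq_self_of_not_mem_stabGen`: **`x ∉ 𝒦`, `x² ∈ 𝒦 ⇒ x² = c`** (`x⁴ = 1` and `c ∈ ⟨x⟩ = {1, x, x², x³}`).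
* §2 `mul_comm_of_mul_self_eq_self`: **every `x` with `x² = c` centralises `𝒦`** (else `x·e` would be a root with `(xe)² ≠ c`).
* §3 `mul_rev_eq_of_mul_self` (the swap rule `yx = xy·c` when `x² = y² = (xy)² = c`) and the **SEVEN-PRODUCTS LEMMA**
  `mul_mul_mem_stabGen_of_not_mem`: if `x, y, z, xy, xz, yz ∉ 𝒦` all have their squares in `𝒦`, then `xyz ∈ 𝒦`
  (`(xyz)² = c⁴ = 1`).  Equivalently: `G/𝒦` contains no subgroup `(ℤ/2)³` — memo Q3 in the family (K2).
* §4 **The `2`-rank bound**: for every subgroup `H` with `∀ h ∈ H, h² ∈ 𝒦` (`H𝒦/𝒦` of exponent two), `H` is covered by four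
  cosets of `𝒦` (`exists_cover_four_of_sq_mem_stabGen`), so `H ⧸ (𝒦 ⊓ H)` is finite of order `≤ 4`
  (`finite_quotient_stabGen_of_sq_mem`, `card_quotient_stabGen_le_four`, `relIndex_stabGen_le_four`, `relIndex_stabGen_ne_zero`):
  **every elementary abelian section `H/𝒦` of `G/𝒦` has rank `≤ 2`.**
* §5 (no (K2) needed) **functoriality**: `ker_le_stabGen` (`f c ≠ 1 ⇒ ker f ≤ 𝒦`) and `stabGen_map_le` (`f` onto ⇒
  `𝒦(G', f c) ≤ f(𝒦(G,c))`): `G/𝒦` is a quotient of `(G/L)/𝒦(G/L)` for every `L ⊴ G` with `c ∉ L`.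
* §6 (no (K2) needed) **THEOREM B of the memo — reduction to (K2)**: if `c ∉ N ⊴ G` and `k² ∈ N` for all `k ∈ 𝒦` (e.g. `N = Φ(𝒦)`),
  then `𝒦(G ⧸ N, c̄) = 𝒦.map mk` (`stabGen_mk_eq_map`), it has exponent two (`expTwo_stabGen_quotient`: the pair `(G ⧸ N, c̄)`
  satisfies (K2)), and `(G ⧸ N) ⧸ 𝒦(G ⧸ N, c̄) ≃* G ⧸ 𝒦` (`nonempty_quotient_stabGen_mulEquiv`).  So §1–§4 (rank of elementary abelian
  sections `≤ 2`) hold for `G/𝒦` of EVERY pair with `c ∉ Φ(𝒦)`; the case `c ∈ Φ(𝒦)` is open (memo §2.5).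
CONSEQUENCES RECORDED IN THE MEMO, NOT HERE (they need [Gor82, Thm 1.36 (ii)] = MacWilliams 1970, absent from Mathlib): under (K2)
the group `Ω₁(G/𝒦)` is cyclic or dihedral, `G/𝒦` has no normal `(ℤ/2)³`, hence sectional rank `≤ 4` and **`d₂(G/𝒦) ≤ 4`**; and
`d₂ = 4` IS attained (a pair of order `2¹³` with `G/𝒦 ≅ Q₈ × Q₈`, GAP certificate in the memo of gen 21).

## References
* [Gor82] D. Gorenstein, Finite Simple Groups, Plenum 1982, Thm 1.36 (ii), p. 49 (a `2`-group of normal rank `≤ 2` has sectional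
  rank `≤ 4`; A. MacWilliams, Trans. AMS 150 (1970) 345–408) — cited for context only, not used in this file.
* [Pohlmann1968] H. Pohlmann, Algebraic cycles on abelian varieties of complex multiplication type, Ann. of Math. 88 (1968), Thm 1.
-/

namespace Summit.HodgeConjecture.CorCM.Census.TypeStabiliser

section RankTwo

variable {G : Type*} [Group G] (c : G)

/-! ## §1 The family (K2): `𝒦` of exponent two -/

/-- Under (K2), `c² = 1` (`c ∈ 𝒦`). [folklore] -/
theorem self_mul_self_eq_one_of_expTwo (hK : ∀ g ∈ stabGen c, g * g = 1) : c * c = 1 :=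
  hK c (self_mem_stabGen c)

/-- Under (K2) and `c ≠ 1`: **`g ∈ 𝒦 ↔ g² = 1`** — `𝒦` is exactly the set of involutions together with `1`
(`mem_stabGen_of_mul_self_eq_one` for `⇐`). [folklore] -/
theorem mem_stabGen_iff_mul_self_eq_one (hc1 : c ≠ 1) (hK : ∀ g ∈ stabGen c, g * g = 1) (g : G) :
    g ∈ stabGen c ↔ g * g = 1 :=
  ⟨hK g, mem_stabGen_of_mul_self_eq_one c hc1⟩

/-- An element outside `𝒦` is a root of `c`: `c ∈ ⟨x⟩`. [folklore] -/
theorem mem_zpowers_of_not_mem_stabGen {x : G} (hx : x ∉ stabGen c) : c ∈ Subgroup.zpowers x := by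
  by_contra h
  exact hx (mem_stabGen_of_notMem_zpowers c h)

/-- **§1.  `x ∉ 𝒦`, `x² ∈ 𝒦 ⇒ x² = c`** under (K2), `c ≠ 1`: `x⁴ = (x²)² = 1`, and `c ∈ ⟨x⟩ = {1, x, x², x³}` with `c ≠ 1`,
`c ≠ x` (`x ∉ 𝒦 ∋ c`), `c ≠ x³` (else `x = c⁻¹ ∈ 𝒦`). [folklore] -/
theorem mul_self_eq_self_of_not_mem_stabGen (hc1 : c ≠ 1) (hK : ∀ g ∈ stabGen c, g * g = 1) {x : G}
    (hx : x ∉ stabGen c) (hx2 : x * x ∈ stabGen c) : x * x = c := by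
  have h4 : x * x * (x * x) = 1 := hK _ hx2
  have hx4 : x ^ (4 : ℕ) = 1 := by
    rw [show x ^ (4 : ℕ) = x * x * (x * x) by simp only [pow_succ, pow_zero, one_mul, mul_assoc]]
    exact h4
  obtain ⟨k, hk⟩ := Subgroup.mem_zpowers_iff.mp (mem_zpowers_of_not_mem_stabGen c hx)
  have hkm : x ^ (k % 4) = c := by
    have e := zpow_eq_zpow_emod' k hx4
    push_cast at e
    rw [← e]
    exact hk
  have hlo : 0 ≤ k % 4 := Int.emod_nonneg k (by norm_num)
  have hhi : k % 4 < 4 := Int.emod_lt_of_pos k (by norm_num)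
  obtain ⟨r, hr, hr4⟩ : ∃ r : ℕ, (r : ℤ) = k % 4 ∧ r < 4 :=
    ⟨(k % 4).toNat, Int.toNat_of_nonneg hlo, by omega⟩
  rw [← hr, zpow_natCast] at hkm
  interval_cases r
  · rw [pow_zero] at hkm
    exact absurd hkm.symm hc1
  · rw [pow_one] at hkm
    rw [hkm] at hx
    exact absurd (self_mem_stabGen c) hx
  · rw [pow_two] at hkm
    exact hkm
  · -- `x³ = c ⇒ x⁴ = x³·x = c·x = 1 ⇒ x = c⁻¹ ∈ 𝒦`
    exfalso
    have e3 : c * x = 1 := by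
      rw [← hkm, ← pow_succ]
      exact hx4
    have hx1 : x = c⁻¹ := eq_inv_of_mul_eq_one_right e3
    rw [hx1] at hx
    exact hx ((stabGen c).inv_mem (self_mem_stabGen c))

/-! ## §2 Square roots of `c` centralise `𝒦` -/

/-- **§2.  If `x² = c` then `x` commutes with every element of `𝒦`** (under (K2), `c ≠ 1` central): for `e ∈ 𝒦` the element
`xe ∉ 𝒦` has `(xe)² = (x e x⁻¹)·c·e ∈ 𝒦`, so `(xe)² = c` by §1, i.e. `x e x⁻¹ = e⁻¹ = e`. [folklore] -/
theorem mul_comm_of_mul_self_eq_self (hc1 : c ≠ 1) (hcen : ∀ g : G, g * c = c * g) (hK : ∀ g ∈ stabGen c, g * g = 1)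
    {x e : G} (hx : x * x = c) (he : e ∈ stabGen c) : x * e = e * x := by
  have hxK : x ∉ stabGen c := by
    intro h
    apply hc1
    rw [← hx]
    exact hK x h
  have he' : x * e * x⁻¹ ∈ stabGen c := (stabGen_normal c hcen).conj_mem e he x
  have hy : x * e ∉ stabGen c := by
    intro h
    apply hxK
    have h' := (stabGen c).mul_mem h ((stabGen c).inv_mem he)
    rwa [mul_inv_cancel_right] at h'
  have e1 : x * e * (x * e) = x * e * x⁻¹ * (c * e) := by
    rw [← hx]
    group
  have hy2 : x * e * (x * e) ∈ stabGen c := by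
    rw [e1]
    exact (stabGen c).mul_mem he' ((stabGen c).mul_mem (self_mem_stabGen c) he)
  have hsq : x * e * (x * e) = c := mul_self_eq_self_of_not_mem_stabGen c hc1 hK hy hy2
  have h3 : x * e * x⁻¹ * e * c = 1 * c := by
    rw [one_mul, mul_assoc (x * e * x⁻¹) e c, hcen e, ← e1]
    exact hsq
  have h1 : x * e * x⁻¹ * e = 1 := mul_right_cancel h3
  have h4 : x * e * x⁻¹ = e⁻¹ := eq_inv_of_mul_eq_one_left h1
  rw [inv_eq_of_mul_eq_one_right (hK e he)] at h4
  exact mul_inv_eq_iff_eq_mul.mp h4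

/-! ## §3 The swap rule and the seven-products lemma -/

/-- **The swap rule**: `x² = y² = (xy)² = c` (with `c² = 1`, `c` central) forces `yx = xy·c`. [folklore] -/
theorem mul_rev_eq_of_mul_self (hc2 : c * c = 1) {x y : G} (hx : x * x = c)
    (hy : y * y = c) (hxy : x * y * (x * y) = c) : y * x = x * y * c := by
  have hxinv : x⁻¹ = x * c := by rw [inv_eq_iff_mul_eq_one, ← mul_assoc, hx, hc2]
  have hyinv : y⁻¹ = y * c := by rw [inv_eq_iff_mul_eq_one, ← mul_assoc, hy, hc2]
  calc y * x = x⁻¹ * (x * y * (x * y)) * y⁻¹ := by group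
    _ = x⁻¹ * c * y⁻¹ := by rw [hxy]
    _ = x * c * c * (y * c) := by rw [hxinv, hyinv]
    _ = x * y * c := by rw [mul_assoc x c c, hc2, mul_one, ← mul_assoc]

/-- **§3.  THE SEVEN-PRODUCTS LEMMA.**  Under (K2) (`c ≠ 1` central): if `x, y, z, xy, xz, yz` all lie outside `𝒦` and all have
their squares in `𝒦`, then `xyz ∈ 𝒦`.  (By §1 all six squares equal `c`; by the swap rule `yx = xyc`, `zx = xzc`, `zy = yzc`,
whence `(xyz)² = c⁴ = 1`.)  In words: `G/𝒦` has no subgroup `(ℤ/2)³`. [folklore] -/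
theorem mul_mul_mem_stabGen_of_not_mem (hc1 : c ≠ 1) (hcen : ∀ g : G, g * c = c * g) (hK : ∀ g ∈ stabGen c, g * g = 1)
    {x y z : G} (hx : x ∉ stabGen c) (hy : y ∉ stabGen c) (hz : z ∉ stabGen c) (hxy : x * y ∉ stabGen c)
    (hxz : x * z ∉ stabGen c) (hyz : y * z ∉ stabGen c) (hx2 : x * x ∈ stabGen c) (hy2 : y * y ∈ stabGen c)
    (hz2 : z * z ∈ stabGen c) (hxy2 : x * y * (x * y) ∈ stabGen c) (hxz2 : x * z * (x * z) ∈ stabGen c)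
    (hyz2 : y * z * (y * z) ∈ stabGen c) : x * y * z ∈ stabGen c := by
  have hc2 : c * c = 1 := self_mul_self_eq_one_of_expTwo c hK
  have ex : x * x = c := mul_self_eq_self_of_not_mem_stabGen c hc1 hK hx hx2
  have ey : y * y = c := mul_self_eq_self_of_not_mem_stabGen c hc1 hK hy hy2
  have ez : z * z = c := mul_self_eq_self_of_not_mem_stabGen c hc1 hK hz hz2
  have exy : x * y * (x * y) = c := mul_self_eq_self_of_not_mem_stabGen c hc1 hK hxy hxy2
  have exz : x * z * (x * z) = c := mul_self_eq_self_of_not_mem_stabGen c hc1 hK hxz hxz2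
  have eyz : y * z * (y * z) = c := mul_self_eq_self_of_not_mem_stabGen c hc1 hK hyz hyz2
  have syx : y * x = x * y * c := mul_rev_eq_of_mul_self c hc2 ex ey exy
  have szx : z * x = x * z * c := mul_rev_eq_of_mul_self c hc2 ex ez exz
  have szy : z * y = y * z * c := mul_rev_eq_of_mul_self c hc2 ey ez eyz
  -- rewrite rules on right-associated words
  have A : ∀ w : G, x * (x * w) = c * w := fun w => by rw [← mul_assoc, ex]
  have B : ∀ w : G, y * (y * w) = c * w := fun w => by rw [← mul_assoc, ey]
  have Sxy : ∀ w : G, y * (x * w) = x * (y * (c * w)) := fun w => by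
    rw [← mul_assoc, syx]; simp only [mul_assoc]
  have Sxz : ∀ w : G, z * (x * w) = x * (z * (c * w)) := fun w => by
    rw [← mul_assoc, szx]; simp only [mul_assoc]
  have Syz : ∀ w : G, z * (y * w) = y * (z * (c * w)) := fun w => by
    rw [← mul_assoc, szy]; simp only [mul_assoc]
  have Hy : ∀ w : G, c * (y * w) = y * (c * w) := fun w => by rw [← mul_assoc, ← hcen y, mul_assoc]
  have CC : ∀ w : G, c * (c * w) = w := fun w => by rw [← mul_assoc, hc2, one_mul]
  apply mem_stabGen_of_mul_self_eq_one c hc1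
  show x * y * z * (x * y * z) = 1
  simp only [mul_assoc]
  rw [Sxz (y * z), Sxy (z * (c * (y * z))), A (y * (c * (z * (c * (y * z))))), Hy (c * (z * (c * (y * z)))),
    CC (z * (c * (y * z))), Hy z, Syz (c * z), CC z, B (z * z), ez, hc2]

/-! ## §4 The `2`-rank of `G/𝒦` is at most two -/

/-- **Four cosets cover.**  Under (K2) (`c ≠ 1` central): if every `h ∈ H` has `h² ∈ 𝒦` (i.e. `H𝒦/𝒦` has exponent two),
then there are `x, y ∈ H` with `H ⊆ 𝒦 ∪ x⁻¹𝒦 ∪ y⁻¹𝒦 ∪ (xy)⁻¹𝒦`. [folklore] -/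
theorem exists_cover_four_of_sq_mem_stabGen (hc1 : c ≠ 1) (hcen : ∀ g : G, g * c = c * g)
    (hK : ∀ g ∈ stabGen c, g * g = 1) {H : Subgroup G} (hH : ∀ h ∈ H, h * h ∈ stabGen c) :
    ∃ x ∈ H, ∃ y ∈ H, ∀ h ∈ H,
      h ∈ stabGen c ∨ x * h ∈ stabGen c ∨ y * h ∈ stabGen c ∨ x * y * h ∈ stabGen c := by
  by_cases h1 : ∀ h ∈ H, h ∈ stabGen c
  · exact ⟨1, H.one_mem, 1, H.one_mem, fun h hh => Or.inl (h1 h hh)⟩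
  push Not at h1
  obtain ⟨x, hxH, hxK⟩ := h1
  by_cases h2 : ∀ h ∈ H, h ∈ stabGen c ∨ x * h ∈ stabGen c
  · refine ⟨x, hxH, 1, H.one_mem, fun h hh => ?_⟩
    rcases h2 h hh with h' | h'
    · exact Or.inl h'
    · exact Or.inr (Or.inl h')
  push Not at h2
  obtain ⟨y, hyH, hyK, hxyK⟩ := h2
  refine ⟨x, hxH, y, hyH, fun h hh => ?_⟩
  by_contra hcon
  push Not at hcon
  obtain ⟨hhK, hxh, hyh, hxyh⟩ := hcon
  apply hxyh
  exact mul_mul_mem_stabGen_of_not_mem c hc1 hcen hK hxK hyK hhK hxyK hxh hyh (hH x hxH) (hH y hyH) (hH h hh)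
    (hH _ (H.mul_mem hxH hyH)) (hH _ (H.mul_mem hxH hh)) (hH _ (H.mul_mem hyH hh))

/-- **`H ⧸ (𝒦 ⊓ H)` has at most four elements** (under (K2), `c ≠ 1` central, for `H` as above): a surjection from `Fin 4`
onto the quotient of `H` by `stabGen c` restricted to `H`. [folklore] -/
theorem exists_surjective_fin_four_quotient_stabGen (hc1 : c ≠ 1) (hcen : ∀ g : G, g * c = c * g)
    (hK : ∀ g ∈ stabGen c, g * g = 1) {H : Subgroup G} (hH : ∀ h ∈ H, h * h ∈ stabGen c) :
    ∃ f : Fin 4 → H ⧸ (stabGen c).subgroupOf H, Function.Surjective f := by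
  obtain ⟨x, hxH, y, hyH, hcov⟩ := exists_cover_four_of_sq_mem_stabGen c hc1 hcen hK hH
  let q0 : H ⧸ (stabGen c).subgroupOf H := QuotientGroup.mk 1
  let q1 : H ⧸ (stabGen c).subgroupOf H := QuotientGroup.mk ⟨x⁻¹, H.inv_mem hxH⟩
  let q2 : H ⧸ (stabGen c).subgroupOf H := QuotientGroup.mk ⟨y⁻¹, H.inv_mem hyH⟩
  let q3 : H ⧸ (stabGen c).subgroupOf H := QuotientGroup.mk ⟨(x * y)⁻¹, H.inv_mem (H.mul_mem hxH hyH)⟩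
  refine ⟨fun i => if i = 0 then q0 else if i = 1 then q1 else if i = 2 then q2 else q3, fun q => ?_⟩
  induction q using QuotientGroup.induction_on with
  | H z =>
    obtain ⟨h, hh⟩ := z
    rcases hcov h hh with h0 | h0 | h0 | h0
    · refine ⟨0, ?_⟩
      simp only [if_true, q0]
      refine QuotientGroup.eq.mpr ?_
      rw [Subgroup.mem_subgroupOf]
      simpa using h0
    · refine ⟨1, ?_⟩
      simp only [show (1 : Fin 4) ≠ 0 by decide, if_false, if_true, q1]
      refine QuotientGroup.eq.mpr ?_
      rw [Subgroup.mem_subgroupOf]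
      simpa using h0
    · refine ⟨2, ?_⟩
      simp only [show (2 : Fin 4) ≠ 0 by decide, show (2 : Fin 4) ≠ 1 by decide, if_false, if_true, q2]
      refine QuotientGroup.eq.mpr ?_
      rw [Subgroup.mem_subgroupOf]
      simpa using h0
    · refine ⟨3, ?_⟩
      simp only [show (3 : Fin 4) ≠ 0 by decide, show (3 : Fin 4) ≠ 1 by decide, show (3 : Fin 4) ≠ 2 by decide,
        if_false, q3]
      refine QuotientGroup.eq.mpr ?_
      rw [Subgroup.mem_subgroupOf]
      simpa [mul_assoc] using h0

/-- **`H ⧸ (𝒦 ⊓ H)` is finite** (under (K2), `c ≠ 1` central, `∀ h ∈ H, h² ∈ 𝒦`) — no finiteness of `G` assumed. [folklore] -/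
theorem finite_quotient_stabGen_of_sq_mem (hc1 : c ≠ 1) (hcen : ∀ g : G, g * c = c * g)
    (hK : ∀ g ∈ stabGen c, g * g = 1) {H : Subgroup G} (hH : ∀ h ∈ H, h * h ∈ stabGen c) :
    Finite (H ⧸ (stabGen c).subgroupOf H) := by
  obtain ⟨f, hf⟩ := exists_surjective_fin_four_quotient_stabGen c hc1 hcen hK hH
  exact Finite.of_surjective f hf

/-- **THE `2`-RANK BOUND: `|H ⧸ (𝒦 ⊓ H)| ≤ 4`** for every `H` with `∀ h ∈ H, h² ∈ 𝒦` (under (K2), `c ≠ 1` central) — every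
elementary abelian section `H/𝒦` (`𝒦 ≤ H`) of `G/𝒦` has rank `≤ 2`; with `finite_quotient_stabGen_of_sq_mem` the bound is not
vacuous. [folklore] -/
theorem card_quotient_stabGen_le_four (hc1 : c ≠ 1) (hcen : ∀ g : G, g * c = c * g)
    (hK : ∀ g ∈ stabGen c, g * g = 1) {H : Subgroup G} (hH : ∀ h ∈ H, h * h ∈ stabGen c) :
    Nat.card (H ⧸ (stabGen c).subgroupOf H) ≤ 4 := by
  obtain ⟨f, hf⟩ := exists_surjective_fin_four_quotient_stabGen c hc1 hcen hK hH
  have h := Nat.card_le_card_of_surjective f hf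
  simpa using h

/-- The same in the `relIndex` currency: **`[H : 𝒦 ⊓ H] ≤ 4`** (`Subgroup.relIndex`; under (K2), `c ≠ 1` central,
`∀ h ∈ H, h² ∈ 𝒦`). [folklore] -/
theorem relIndex_stabGen_le_four (hc1 : c ≠ 1) (hcen : ∀ g : G, g * c = c * g)
    (hK : ∀ g ∈ stabGen c, g * g = 1) {H : Subgroup G} (hH : ∀ h ∈ H, h * h ∈ stabGen c) :
    (stabGen c).relIndex H ≤ 4 :=
  card_quotient_stabGen_le_four c hc1 hcen hK hH

/-- … and `[H : 𝒦 ⊓ H] ≠ 0` (the quotient is finite). [folklore] -/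
theorem relIndex_stabGen_ne_zero (hc1 : c ≠ 1) (hcen : ∀ g : G, g * c = c * g)
    (hK : ∀ g ∈ stabGen c, g * g = 1) {H : Subgroup G} (hH : ∀ h ∈ H, h * h ∈ stabGen c) :
    (stabGen c).relIndex H ≠ 0 := by
  haveI := finite_quotient_stabGen_of_sq_mem c hc1 hcen hK hH
  exact Subgroup.index_ne_zero_iff_finite.mpr ‹_›

end RankTwo

/-! ## §5 Functoriality of `𝒦` (no hypothesis (K2)): quotients can only enlarge `G/𝒦` -/

section Functorial

variable {G G' : Type*} [Group G] [Group G'] (c : G)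

/-- **A kernel missing `c` lies in `𝒦`**: if `f c ≠ 1` then every `l ∈ ker f` has `c ∉ ⟨l⟩` (else `f c ∈ f⟨l⟩ = 1`).
[folklore] -/
theorem ker_le_stabGen (f : G →* G') (hc : f c ≠ 1) : f.ker ≤ stabGen c := by
  intro l hl
  refine mem_stabGen_of_notMem_zpowers c fun h => hc ?_
  have h' : f c ∈ (Subgroup.zpowers l).map f := Subgroup.mem_map_of_mem f h
  rw [MonoidHom.map_zpowers, (MonoidHom.mem_ker).mp hl, Subgroup.zpowers_one_eq_bot, Subgroup.mem_bot] at h'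
  exact h'

/-- **`𝒦` of a quotient lies in the image of `𝒦`**: for a surjection `f`, `stabGen (f c) ≤ (stabGen c).map f` — a non-root
`g'` of `f c` lifts to `g` with `c ∉ ⟨g⟩` (as `f⟨g⟩ = ⟨g'⟩`).  With `ker_le_stabGen`: for `L ⊴ G`, `c ∉ L`, the group `G/𝒦(G,c)`
is a QUOTIENT of `(G/L)/𝒦(G/L, cL)`, so `d₂` can only grow under such quotients (used in the lane memo to reduce bounds on `d₂`
to groups with cyclic centre). [folklore] -/
theorem stabGen_map_le (f : G →* G') (hf : Function.Surjective f) : stabGen (f c) ≤ (stabGen c).map f := by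
  rw [stabGen, Subgroup.closure_le]
  rintro g' (hg' | hg')
  · rw [Set.mem_singleton_iff] at hg'
    rw [hg']
    exact Subgroup.mem_map_of_mem f (self_mem_stabGen c)
  · obtain ⟨g, rfl⟩ := hf g'
    refine Subgroup.mem_map_of_mem f (mem_stabGen_of_notMem_zpowers c fun h => hg' ?_)
    have h' : f c ∈ (Subgroup.zpowers g).map f := Subgroup.mem_map_of_mem f h
    rwa [MonoidHom.map_zpowers] at h'

/-- The two together: for a surjection `f` with `f c ≠ 1`, **`(stabGen c).map f` contains `stabGen (f c)` and `f.ker ≤ stabGen c`**,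
so `G ⧸ stabGen c ≅ G' ⧸ (stabGen c).map f` is a quotient of `G' ⧸ stabGen (f c)`. [folklore] -/
theorem ker_le_stabGen_and_stabGen_map_le (f : G →* G') (hf : Function.Surjective f) (hc : f c ≠ 1) :
    f.ker ≤ stabGen c ∧ stabGen (f c) ≤ (stabGen c).map f :=
  ⟨ker_le_stabGen c f hc, stabGen_map_le c f hf⟩

end Functorial

/-! ## §6 THEOREM B of the memo: the quotient by the squares of `𝒦` lands in the family (K2) with the same `G/𝒦` -/

section Reduction

variable {G : Type*} [Group G] (c : G)

/-- **𝒦 of the quotient `G ⧸ N` is the image of `𝒦`** whenever `c ∉ N ⊴ G` and every element of `𝒦` has its square in `N` (e.g.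
`N = Φ(𝒦)` for a `2`-group): the image of `𝒦` has exponent two, so consists of `1`, `c̄` and involutions `≠ c̄`, all in `𝒦(G ⧸ N, c̄)`;
the other inclusion is `stabGen_map_le`. [folklore] -/
theorem stabGen_mk_eq_map (N : Subgroup G) [N.Normal] (hcN : c ∉ N) (hsq : ∀ k ∈ stabGen c, k * k ∈ N) :
    stabGen (QuotientGroup.mk c : G ⧸ N) = (stabGen c).map (QuotientGroup.mk' N) := by
  apply le_antisymm
  · exact stabGen_map_le c (QuotientGroup.mk' N) (QuotientGroup.mk'_surjective N)
  · rintro _ ⟨k, hk, rfl⟩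
    have hc1 : (QuotientGroup.mk c : G ⧸ N) ≠ 1 := fun h => hcN ((QuotientGroup.eq_one_iff c).mp h)
    apply mem_stabGen_of_mul_self_eq_one _ hc1
    rw [QuotientGroup.mk'_apply, ← QuotientGroup.mk_mul, QuotientGroup.eq_one_iff]
    exact hsq k hk

/-- **THEOREM B (reduction to (K2)).**  If `c ∉ N ⊴ G` and `k² ∈ N` for every `k ∈ 𝒦`, then the pair `(G ⧸ N, c̄)` satisfies (K2):
every element of `𝒦(G ⧸ N, c̄)` squares to `1`.  So §1–§4 apply to `G ⧸ N` — and `G ⧸ N ⧸ 𝒦(G ⧸ N, c̄) ≃* G ⧸ 𝒦`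
(`nonempty_quotient_stabGen_mulEquiv`). [folklore] -/
theorem expTwo_stabGen_quotient (N : Subgroup G) [N.Normal] (hcN : c ∉ N) (hsq : ∀ k ∈ stabGen c, k * k ∈ N) :
    ∀ g ∈ stabGen (QuotientGroup.mk c : G ⧸ N), g * g = 1 := by
  rw [stabGen_mk_eq_map c N hcN hsq]
  rintro _ ⟨k, hk, rfl⟩
  rw [QuotientGroup.mk'_apply, ← QuotientGroup.mk_mul, QuotientGroup.eq_one_iff]
  exact hsq k hk

/-- `c` stays central in `G ⧸ N`. [folklore] -/
theorem mk_mul_comm_of_comm (N : Subgroup G) [N.Normal] (hcen : ∀ g : G, g * c = c * g) :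
    ∀ x : G ⧸ N, x * (QuotientGroup.mk c : G ⧸ N) = (QuotientGroup.mk c : G ⧸ N) * x := by
  intro x
  induction x using QuotientGroup.induction_on with
  | H g => rw [← QuotientGroup.mk_mul, ← QuotientGroup.mk_mul, hcen g]

/-- **Same quotient**: under the hypotheses of Theorem B, `(G ⧸ N) ⧸ 𝒦(G ⧸ N, c̄) ≃* G ⧸ 𝒦(G, c)` (third isomorphism theorem;
`N ≤ 𝒦` by `ker_le_stabGen`; the two `Normal` instances are `stabGen_normal` with `mk_mul_comm_of_comm`).  Stated as `Nonempty` to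
keep this file definition-free. [folklore] -/
theorem nonempty_quotient_stabGen_mulEquiv (N : Subgroup G) [N.Normal] [(stabGen c).Normal]
    [(stabGen (QuotientGroup.mk c : G ⧸ N)).Normal] (hcN : c ∉ N) (hsq : ∀ k ∈ stabGen c, k * k ∈ N) :
    Nonempty ((G ⧸ N) ⧸ stabGen (QuotientGroup.mk c : G ⧸ N) ≃* G ⧸ stabGen c) := by
  have hN : N ≤ stabGen c := by
    have h := ker_le_stabGen c (QuotientGroup.mk' N) (fun h => hcN ((QuotientGroup.eq_one_iff c).mp h))
    rwa [QuotientGroup.ker_mk'] at h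
  exact ⟨(QuotientGroup.quotientMulEquivOfEq (stabGen_mk_eq_map c N hcN hsq)).trans
    (QuotientGroup.quotientQuotientEquivQuotient N (stabGen c) hN)⟩

end Reduction

end Summit.HodgeConjecture.CorCM.Census.TypeStabiliser
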